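import Summits.ResolutionOfSingularities.ResolutionOfSingularities.Theorems.PurelyInseparableDim4ResConeTwoSlotGameFree
import HarnessLib
import HarnessLib.Audit.Tags

/-!
# Purely inseparable four-folds — TWO-SLOT GAME, SECOND AMENDMENT (rotating letters, unit-class transfer with GENERAL
# units): every relabeling may leak to its one live lower shadow, and the flag gains two exits (cell `res-dim4-pi`, K2(p)
# lane, slice B brick K24a, R1′ part γ₀‴)

[OURS · counted 0 · cell `res-dim4-pi` · K2(p) lane; K24a-R1′(β) shadow audit refined (seat res-dim4-p-1 g4, NOTES/HANDOFF
2026-08-29 05:0xZ): through a rotation step the composite unit-class substitution between the two canonical frames has units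
depending on ALL letters (the target's Tschirnhaus datum enters the swap units), so res-dim4-p-7 g4's triangular transfer
`SwapNorm.coeff_aeval_unitClass` (s = 3) leaves, for each game reading, its componentwise-lower shadows of relative degree ≥ 4
with both slot exponents ≥ 1 — exactly ONE live shadow per relabeling (`x_μ² ∈ S₀` under `x_λx_μ² ∈ S₀`) and two extra flag
exits (`x_λ ∈ S₁`, `x_μ³ ∈ S₀`).  The game survives:]  Nothing here proves K2(p)/K2(5), `NoIsolatedTrap p p` or resolution of
singularities in dimension ≥ 4 / characteristic `p`.  AI kernel work, weaker than expert review.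

THE SECOND-AMENDED INSTANCES (readings `s m a b c` of `S₀`, `t m a b c` of `S₁`; `L m` = slot-`λ` step):
* relabelings, each with its live lower shadow as an alternative: `hfix : L m → s m 1 2 0 ≠ 0 → s (m+1) 1 2 0 ≠ 0 ∨ s (m+1) 0 2 0 ≠ 0`,
  `hfix' : L m → s m 0 2 0 ≠ 0 → s (m+1) 0 2 0 ≠ 0` (`x_μ²` is `λ`-fixed, clean), `hmuA` (clean), `hmuB : ¬L m → s m 1 3 0 ≠ 0 →
  s (m+1) 1 2 0 ≠ 0 ∨ s (m+1) 0 2 0 ≠ 0`, `hmuT : ¬L m → t m 1 0 0 ≠ 0 → t (m+1) 1 0 0 ≠ 0` (clean);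
* legality (read in the parent's own frame — no transfer): `hlegL : L m → s m 1 1 0 = 0 ∧ t m 1 0 0 = 0`,
  `hlegM : ¬L m → s m 0 2 0 = 0 ∧ s m 1 1 0 = 0 ∧ s m 0 1 1 = 0 ∧ t m 0 1 0 = 0 ∧ s m 0 3 0 = 0` (all five are β5's);
* flag after a `λ`-step: the six, or `t (m+1) 1 0 0 ≠ 0`, or `s (m+1) 0 3 0 ≠ 0`.

* §1 **`twoSlot_freeze_or_flip'`** — after `λ` at `k`, `μ` at `k+1`: either every step from `k+2` on is `λ` (carried by the
  absorbing pair «`x_λx_μ² ∈ S₀` or `x_μ² ∈ S₀`»), or every step from `k+1` on is `μ` (carried by `x_λ ∈ S₁`).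
* §2 **`twoSlot_eventually_constant'''`**, **`no_twoSlot_tail_of_readings_rotating`** — one slot for ever ⇒ free tail (γ₀′ §2).

[cite: CossartJannsenSaito2020, Thm. 3.14, Thm. 9.3] bears_on: LADDER-RESOLUTION:D157-DOOR2 (res-dim4-pi · K2(p) · slice B ·
K24a-R1′ γ₀‴).  Supports stmt-ResolutionOfSingularities-16155 (helper).
-/

set_option linter.dupNamespace false -- mandated namespace of this single-conjunct summit

namespace Summit.ResolutionOfSingularities.ResolutionOfSingularities.Theorems.PIDim4

namespace ResCone

open Literature.AlgebraicGeometry.Resolution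
open Literature.AlgebraicGeometry.Resolution.CentreBlowup

variable {K : Type} [Field K]

/-! ## 1. Freeze or flip, second amendment -/

/-- **FREEZE OR FLIP** (second-amended two-slot game; instances in the module docstring): after `λ` at `k` and `μ` at `k + 1`,
either `∀ m ≥ k+2, L m ∧ (s m 1 2 0 ≠ 0 ∨ s m 0 2 0 ≠ 0)`, or `∀ m ≥ k+1, ¬L m ∧ t m 1 0 0 ≠ 0`.
[OURS · idea-4's argument + the rotation amendments] [folklore] -/
theorem twoSlot_freeze_or_flip' {s t : ℕ → ℕ → ℕ → ℕ → K} {L : ℕ → Prop}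
    (hfix : ∀ m, L m → s m 1 2 0 ≠ 0 → s (m + 1) 1 2 0 ≠ 0 ∨ s (m + 1) 0 2 0 ≠ 0)
    (hfix' : ∀ m, L m → s m 0 2 0 ≠ 0 → s (m + 1) 0 2 0 ≠ 0)
    (hmuA : ∀ m, ¬ L m → s m 1 2 0 ≠ 0 → s (m + 1) 1 1 0 ≠ 0)
    (hmuB : ∀ m, ¬ L m → s m 1 3 0 ≠ 0 → s (m + 1) 1 2 0 ≠ 0 ∨ s (m + 1) 0 2 0 ≠ 0)
    (hmuT : ∀ m, ¬ L m → t m 1 0 0 ≠ 0 → t (m + 1) 1 0 0 ≠ 0)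
    (hlegL : ∀ m, L m → s m 1 1 0 = 0 ∧ t m 1 0 0 = 0)
    (hlegM : ∀ m, ¬ L m → s m 0 2 0 = 0 ∧ s m 1 1 0 = 0 ∧ s m 0 1 1 = 0 ∧ t m 0 1 0 = 0 ∧ s m 0 3 0 = 0)
    (hflag : ∀ m, L m → s (m + 1) 0 2 0 ≠ 0 ∨ s (m + 1) 1 1 0 ≠ 0 ∨ s (m + 1) 0 1 1 ≠ 0 ∨
      s (m + 1) 1 2 0 ≠ 0 ∨ s (m + 1) 1 3 0 ≠ 0 ∨ t (m + 1) 0 1 0 ≠ 0 ∨ t (m + 1) 1 0 0 ≠ 0 ∨ s (m + 1) 0 3 0 ≠ 0)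
    {k : ℕ} (hk : L k) (hk1 : ¬ L (k + 1)) :
    (∀ m, k + 2 ≤ m → L m ∧ (s m 1 2 0 ≠ 0 ∨ s m 0 2 0 ≠ 0)) ∨ (∀ m, k + 1 ≤ m → ¬ L m ∧ t m 1 0 0 ≠ 0) := by
  -- `x_λ x_μ ∈ S₀` is illegal for both letters
  have hkill : ∀ m, s m 1 1 0 ≠ 0 → False := fun m h => by
    by_cases hL : L m
    · exact h (hlegL m hL).1
    · exact h (hlegM m hL).2.1
  -- the absorbing pair forces `λ`
  have hstay : ∀ m, (s m 1 2 0 ≠ 0 ∨ s m 0 2 0 ≠ 0) → L m := fun m h => by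
    by_contra hL
    rcases h with h | h
    · exact hkill (m + 1) (hmuA m hL h)
    · exact h (hlegM m hL).1
  -- … and propagates under `λ`
  have hnext : ∀ m, L m → (s m 1 2 0 ≠ 0 ∨ s m 0 2 0 ≠ 0) → (s (m + 1) 1 2 0 ≠ 0 ∨ s (m + 1) 0 2 0 ≠ 0) :=
    fun m hL h => h.elim (hfix m hL) fun h' => Or.inr (hfix' m hL h')
  -- `x_λ ∈ S₁` forbids `λ` and persists under `μ`
  have hflip : ∀ m₀, t m₀ 1 0 0 ≠ 0 → ∀ m, m₀ ≤ m → ¬ L m ∧ t m 1 0 0 ≠ 0 := by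
    intro m₀ h0 m hm
    induction m, hm using Nat.le_induction with
    | base => exact ⟨fun hL => h0 (hlegL m₀ hL).2, h0⟩
    | succ m _ ih =>
      have h' : t (m + 1) 1 0 0 ≠ 0 := hmuT m ih.1 ih.2
      exact ⟨fun hL => h' (hlegL (m + 1) hL).2, h'⟩
  -- the freeze from an absorbing witness at `k + 2`
  have hfreeze : (s (k + 2) 1 2 0 ≠ 0 ∨ s (k + 2) 0 2 0 ≠ 0) →
      ∀ m, k + 2 ≤ m → L m ∧ (s m 1 2 0 ≠ 0 ∨ s m 0 2 0 ≠ 0) := by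
    intro h0 m hm
    induction m, hm using Nat.le_induction with
    | base => exact ⟨hstay _ h0, h0⟩
    | succ m _ ih => exact ⟨hstay _ (hnext m ih.1 ih.2), hnext m ih.1 ih.2⟩
  -- the flag at `k + 1`
  obtain ⟨h020, h110, h011, h010, h030⟩ := hlegM (k + 1) hk1
  rcases hflag k hk with h | h | h | h | h | h | h | h
  · exact absurd h020 h
  · exact absurd h110 h
  · exact absurd h011 h
  · exact (hkill (k + 2) (hmuA (k + 1) hk1 h)).elim
  · exact Or.inl (hfreeze (hmuB (k + 1) hk1 h))
  · exact absurd h010 h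
  · exact Or.inr (hflip (k + 1) h)
  · exact absurd h030 h

/-! ## 2. One slot moves for ever; the tail is free -/

/-- **THE SLOT IS EVENTUALLY CONSTANT** (second-amended game). [OURS · idea-4's argument + the rotation amendments] [folklore] -/
theorem twoSlot_eventually_constant''' {s t : ℕ → ℕ → ℕ → ℕ → K} {L : ℕ → Prop}
    (hfix : ∀ m, L m → s m 1 2 0 ≠ 0 → s (m + 1) 1 2 0 ≠ 0 ∨ s (m + 1) 0 2 0 ≠ 0)
    (hfix' : ∀ m, L m → s m 0 2 0 ≠ 0 → s (m + 1) 0 2 0 ≠ 0)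
    (hmuA : ∀ m, ¬ L m → s m 1 2 0 ≠ 0 → s (m + 1) 1 1 0 ≠ 0)
    (hmuB : ∀ m, ¬ L m → s m 1 3 0 ≠ 0 → s (m + 1) 1 2 0 ≠ 0 ∨ s (m + 1) 0 2 0 ≠ 0)
    (hmuT : ∀ m, ¬ L m → t m 1 0 0 ≠ 0 → t (m + 1) 1 0 0 ≠ 0)
    (hlegL : ∀ m, L m → s m 1 1 0 = 0 ∧ t m 1 0 0 = 0)
    (hlegM : ∀ m, ¬ L m → s m 0 2 0 = 0 ∧ s m 1 1 0 = 0 ∧ s m 0 1 1 = 0 ∧ t m 0 1 0 = 0 ∧ s m 0 3 0 = 0)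
    (hflag : ∀ m, L m → s (m + 1) 0 2 0 ≠ 0 ∨ s (m + 1) 1 1 0 ≠ 0 ∨ s (m + 1) 0 1 1 ≠ 0 ∨
      s (m + 1) 1 2 0 ≠ 0 ∨ s (m + 1) 1 3 0 ≠ 0 ∨ t (m + 1) 0 1 0 ≠ 0 ∨ t (m + 1) 1 0 0 ≠ 0 ∨ s (m + 1) 0 3 0 ≠ 0) :
    ∃ N, (∀ m, N ≤ m → L m) ∨ (∀ m, N ≤ m → ¬ L m) := by
  by_cases hchange : ∃ k, L k ∧ ¬ L (k + 1)
  · obtain ⟨k, hk, hk1⟩ := hchange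
    rcases twoSlot_freeze_or_flip' hfix hfix' hmuA hmuB hmuT hlegL hlegM hflag hk hk1 with h | h
    · exact ⟨k + 2, Or.inl fun m hm => (h m hm).1⟩
    · exact ⟨k + 1, Or.inr fun m hm => (h m hm).1⟩
  · push Not at hchange
    by_cases hsome : ∃ k, L k
    · obtain ⟨k, hk⟩ := hsome
      refine ⟨k, Or.inl fun m hm => ?_⟩
      induction m, hm using Nat.le_induction with
      | base => exact hk
      | succ m _ ih => exact hchange m ih
    · push Not at hsome
      exact ⟨0, Or.inr fun m _ => hsome m⟩

section Free

variable (p : ℕ) [Fact p.Prime] [CharP K p] [DecidableEq K]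

/-- **THE TWO-SLOT TAIL WITH ROTATING LETTERS, MODULO ITS SECOND-AMENDED READINGS** (K24a-R1′ γ₀‴): slot bookkeeping as in
γ₀′ + the second-amended instances ⇒ `False`. [OURS] [cite: CossartJannsenSaito2020, Thm. 3.14, Thm. 9.3] -/
theorem no_twoSlot_tail_of_readings_rotating {c : ℕ → State K} {j : ℕ → Fin 4} {b : ℕ → Fin 4 → K}
    (hc : ∀ k, IsIsolated p (c k).F) (hw : FreeTail.IsWitnessedChain p c j b) {k₁ : ℕ} {A B : ℕ → Fin 4}
    {L : ℕ → Prop} (hA : ∀ m, L m → A (m + 1) = j (k₁ + m))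
    (hstepA : ∀ m, L m → j (k₁ + m) = A m ∨ b (k₁ + m) (A m) ≠ 0)
    (hB : ∀ m, ¬ L m → B (m + 1) = j (k₁ + m))
    (hstepB : ∀ m, ¬ L m → j (k₁ + m) = B m ∨ b (k₁ + m) (B m) ≠ 0) {s t : ℕ → ℕ → ℕ → ℕ → K}
    (hfix : ∀ m, L m → s m 1 2 0 ≠ 0 → s (m + 1) 1 2 0 ≠ 0 ∨ s (m + 1) 0 2 0 ≠ 0)
    (hfix' : ∀ m, L m → s m 0 2 0 ≠ 0 → s (m + 1) 0 2 0 ≠ 0)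
    (hmuA : ∀ m, ¬ L m → s m 1 2 0 ≠ 0 → s (m + 1) 1 1 0 ≠ 0)
    (hmuB : ∀ m, ¬ L m → s m 1 3 0 ≠ 0 → s (m + 1) 1 2 0 ≠ 0 ∨ s (m + 1) 0 2 0 ≠ 0)
    (hmuT : ∀ m, ¬ L m → t m 1 0 0 ≠ 0 → t (m + 1) 1 0 0 ≠ 0)
    (hlegL : ∀ m, L m → s m 1 1 0 = 0 ∧ t m 1 0 0 = 0)
    (hlegM : ∀ m, ¬ L m → s m 0 2 0 = 0 ∧ s m 1 1 0 = 0 ∧ s m 0 1 1 = 0 ∧ t m 0 1 0 = 0 ∧ s m 0 3 0 = 0)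
    (hflag : ∀ m, L m → s (m + 1) 0 2 0 ≠ 0 ∨ s (m + 1) 1 1 0 ≠ 0 ∨ s (m + 1) 0 1 1 ≠ 0 ∨
      s (m + 1) 1 2 0 ≠ 0 ∨ s (m + 1) 1 3 0 ≠ 0 ∨ t (m + 1) 0 1 0 ≠ 0 ∨ t (m + 1) 1 0 0 ≠ 0 ∨ s (m + 1) 0 3 0 ≠ 0) :
    False := by
  obtain ⟨N, hN⟩ := twoSlot_eventually_constant''' hfix hfix' hmuA hmuB hmuT hlegL hlegM hflag
  rcases hN with hL | hM
  · exact no_free_slot_tail p hc hw hA hstepA hL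
  · exact no_free_slot_tail p hc hw (L := fun m => ¬ L m) hB hstepB hM

end Free

end ResCone

end Summit.ResolutionOfSingularities.ResolutionOfSingularities.Theorems.PIDim4
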